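import Literature.NumberTheory.Rogawski1990.ArchChartOrbGIsolateFinset       -- ★ (J-iso)^T p851292 (this seat): `chartOrbG_eq_prod_mul_integral_pi_group_isolate_of_forall_not_mem`; brings ★ (J-iso) p851229, ★ (A1), ★ `InvariantQuotientPiNormalized`
import Literature.NumberTheory.Rogawski1990.ArchOrbFamGSmoothModel           -- ★ (A4) (LH5-p02 (g4)): `forall_mem_pi_chartTorusGLoc_comm` (the `descConj` binder of a compact-place family)
import HarnessLib

/-!
# `chartOrbG` with a FINITE SET of compact places isolated, the other places read as (split local quotients) × (ONE quotient of the remaining compact places)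
# («(J-iso)^T in the (A1) §3 currency»; Folland 1995 §2.2, §2.6 (2.52); Rogawski 1990 §8.2–8.3)

Topic `NumberTheory/Rogawski1990`; namespace `Literature.NumberTheory.Automorphic.UnitaryGroup`.  THEOREMS ONLY (no `def`, no instance, no notation, no axiom, no named fact,
no `sorry`).  Cell `pub/hodgecm-mathlib`, crux H413 (`stmt-HodgeConjecture-24833`), F0∕P3c line LH3 (closer stub `stub_N9`, DIRECT ROAD `F0_P3c_StubN9Direct`, LEAF v6), organ
O-L1d′ «MIXED SCALAR CORNERS» (`hCm`): the measure-theoretic half of leg **(M1)** «(J2-a)^T, finset∕predicate isolation in the unfolded currency» of F0P3a-p08 (g23)'s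
J2-MIXED spec (2026-09-02T12:01:38Z; dealer LH3-plan (g4) RULING #20), seat F0P3a-p05 (g21).  Count-neutral bookkeeping: nothing here closes an organ.

THE MATHEMATICS.  ★ (J-iso)^T `chartOrbG_eq_prod_mul_integral_pi_group_isolate_of_forall_not_mem` writes, for a decidable predicate `p` selecting compact-chart places
(`hp : p w → w ∉ S′`) and a regular `c`, `chartOrbG ν′ S′ a′ c = (Π_{¬p} t_w(B′_w)) · ∫_{Π_{p} U(α)_w} Θ_c((g_w γ_w(c) g_w⁻¹)_{p}) d(⊗_{p} ν′_w)` with `Θ_c` the partial chart-orbital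
integral over the PRODUCT of the local quotients `Π_{¬p} (U_w ⧸ T′_w)`.  Here that product is re-read as `(Π_{w∈S′} (U_w ⧸ T′_w)) × ((Π_ι U_w) ⧸ Π_ι T′_w)`,
`ι := {w ∕∕ w ∉ S′ ∧ ¬ p w}` the FLAT index of the remaining compact places: the index split `{¬p} = S′ ⊔ ι` is an EXPLICIT measurable equivalence (measure preserving by
Mathlib `Measure.pi_eq` on boxes), and the ι-quotients are ONE quotient by ★ `map_quotientPiHomeomorph_quotientMeasure_pi` (as ★ (A1) §3) for ANY inversion-invariant Haar measure `ρ_ι`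
on `Π_ι T′_w` with coordinates `⊗_ι t_w` (`hρι`; supplied by ★ `exists_haar_map_subgroupPiCoords_eq_pi`).  Bochner change of variables along measurable equivalences only — no Fubini
and no integrability beyond ★ (J-iso)^T's (the one-place case `p := (· = w₀)` is ★ `chartOrbG_eq_prod_mul_integral_group_isolate_splitQuotient`, file `ArchChartOrbGIsolatePlaceSplitQuotient`):
* **`chartOrbG_eq_prod_mul_integral_pi_group_isolate_splitQuotient`**:
  `chartOrbG ν′ S′ a′ c = (Π_{¬p} t_w(B′_w)) · ∫_{Π_{p} U(α)_w} ( ∫ a′(e⁻¹((g_w γ_w(c) g_w⁻¹)_{p} ∣ (ẏ_w γ_w(c) ẏ_w⁻¹)_{w∈S′} ∣ ((h γ_ι(c) h⁻¹)_w)_{w∈ι})) d((⊗_{S′} ν′_w∕t_w) ⊗ ((⊗_ι ν′_w)∕ρ_ι))(y, hΠT′) ) d(⊗_{p} ν′_w)(g)`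
  — the split places still as local QUOTIENTS in `descConj (γ_w(c)) T′_w _ id` currency (what ★ (A2)+(A3) transport and unfold), the remaining compact places through ONE
  `descConj (γ_ι(c)) (Π_ι T′) _` (what ★ (A4′)∕(M3) differentiate), the `p`-slots WHOLE-GROUP variables.
HONEST LABEL: HC_CM is proved only modulo the 7 printed citations (2 remaining: hLiu418 = `stmt-HodgeConjecture-24832`, h413 = `stmt-HodgeConjecture-24833`) until rung 0
closes; this file moves no row of the books.

## References
* [Folland1995] G. B. Folland, *A Course in Abstract Harmonic Analysis* (1995), §2.2 (product measures), §2.6 Thm. 2.49, (2.52).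
* [Rogawski1990] J. D. Rogawski, *Automorphic Representations of Unitary Groups in Three Variables*, Ann. of Math. Stud. 123 (1990), §8.2 p. 122, §8.3 p. 124.
* [Gelbart1975] S. Gelbart, *Automorphic Forms on Adele Groups* (1975), §10 p. 155 (10.19).
* [BorelJacquet1979] A. Borel, H. Jacquet, *Automorphic forms and automorphic representations*, PSPM 33.1 (1979), §4.1.
* [DeitmarEchterhoff2014] A. Deitmar, S. Echterhoff, *Principles of Harmonic Analysis*, 2nd ed. (2014), Cor. 1.5.4, Lemma 9.3.3.
-/

set_option autoImplicit false

noncomputable section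

open MeasureTheory MeasureTheory.Measure NumberField NumberField.InfinitePlace Matrix Complex Topology
open Literature.MeasureTheory.Group Literature.NumberTheory.Rogawski1990
open scoped MatrixGroups Matrix Classical ENNReal NNReal

namespace Literature.NumberTheory.Automorphic.UnitaryGroup

section IsolateFinsetSplitQuotient

variable (L : Type) [Field L] [NumberField L] [IsCMField L] (α : Fin 3 → L) (S' : Finset {w : InfinitePlace L // IsComplex w})
  [∀ w : {w : InfinitePlace L // IsComplex w}, MeasurableSpace ↥(archLocal L 3 (Matrix.diagonal α) w)]
  [∀ w : {w : InfinitePlace L // IsComplex w}, BorelSpace ↥(archLocal L 3 (Matrix.diagonal α) w)]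
  -- ★ `locallyCompactSpace_archLocal_three` ∕ ★ `secondCountableTopology_archLocal_three` (theorems, not instances: supplied by the consumer with `haveI`)
  [∀ w : {w : InfinitePlace L // IsComplex w}, LocallyCompactSpace ↥(archLocal L 3 (Matrix.diagonal α) w)]
  [∀ w : {w : InfinitePlace L // IsComplex w}, SecondCountableTopology ↥(archLocal L 3 (Matrix.diagonal α) w)]
  [MeasurableSpace ↥(arch (↥(maximalRealSubfield L)) L (IsCMField.complexConj L) 3 (Matrix.diagonal α))]
  [BorelSpace ↥(arch (↥(maximalRealSubfield L)) L (IsCMField.complexConj L) 3 (Matrix.diagonal α))]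
  [∀ w : {w : InfinitePlace L // IsComplex w}, MeasurableSpace (↥(archLocal L 3 (Matrix.diagonal α) w) ⧸ chartTorusGLoc L α w S')]
  [∀ w : {w : InfinitePlace L // IsComplex w}, BorelSpace (↥(archLocal L 3 (Matrix.diagonal α) w) ⧸ chartTorusGLoc L α w S')]
  (ν'w : ∀ w : {w : InfinitePlace L // IsComplex w}, Measure ↥(archLocal L 3 (Matrix.diagonal α) w)) [∀ w, (ν'w w).IsHaarMeasure] [∀ w, (ν'w w).IsMulRightInvariant]
  (ν' : Measure ↥(arch (↥(maximalRealSubfield L)) L (IsCMField.complexConj L) 3 (Matrix.diagonal α))) [ν'.IsHaarMeasure] [ν'.IsMulRightInvariant]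
  (hν : ν' = (Measure.pi ν'w).map (archPiEquivCM 3 L (Matrix.diagonal α)).symm)
  (t : ∀ w : {w : InfinitePlace L // IsComplex w}, Measure ↥(chartTorusGLoc L α w S')) [∀ w, (t w).IsHaarMeasure] [∀ w, (t w).IsInvInvariant]
  -- the isolated places: ANY decidable predicate on the complex places, `Fintype` instances of the two index subtypes as BINDERS (as ★ (J-iso)^T), and the quotient of the
  -- REMAINING compact places, flat index `ι = {w ∕∕ w ∉ S′ ∧ ¬ p w}`
  (p : {w : InfinitePlace L // IsComplex w} → Prop) [DecidablePred p]
  [Fintype {w : {w : InfinitePlace L // IsComplex w} // p w}] [Fintype {w : {w : InfinitePlace L // IsComplex w} // ¬ p w}]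
  [MeasurableSpace ((∀ i : {w : {w : InfinitePlace L // IsComplex w} // w ∉ S' ∧ ¬ p w}, ↥(archLocal L 3 (Matrix.diagonal α) i.1)) ⧸
    Subgroup.pi Set.univ (fun i : {w : {w : InfinitePlace L // IsComplex w} // w ∉ S' ∧ ¬ p w} => chartTorusGLoc L α i.1 S'))]
  [BorelSpace ((∀ i : {w : {w : InfinitePlace L // IsComplex w} // w ∉ S' ∧ ¬ p w}, ↥(archLocal L 3 (Matrix.diagonal α) i.1)) ⧸
    Subgroup.pi Set.univ (fun i : {w : {w : InfinitePlace L // IsComplex w} // w ∉ S' ∧ ¬ p w} => chartTorusGLoc L α i.1 S'))]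
  (ρι : Measure ↥(Subgroup.pi Set.univ (fun i : {w : {w : InfinitePlace L // IsComplex w} // w ∉ S' ∧ ¬ p w} => chartTorusGLoc L α i.1 S')))
  [ρι.IsHaarMeasure] [ρι.IsInvInvariant]
  (hρι : Measure.map (subgroupPiCoords fun i : {w : {w : InfinitePlace L // IsComplex w} // w ∉ S' ∧ ¬ p w} => chartTorusGLoc L α i.1 S') ρι =
    Measure.pi fun i : {w : {w : InfinitePlace L // IsComplex w} // w ∉ S' ∧ ¬ p w} => t i.1)

include hν hρι in
/-- **(J-iso)^T IN THE (A1) §3 CURRENCY — THE `p`-PLACES ISOLATED AS WHOLE GROUPS, THE SPLIT PLACES AS LOCAL QUOTIENTS, THE REMAINING COMPACT PLACES AS ONE QUOTIENT.**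
For admissible `S′`, a decidable predicate `p` selecting compact-chart places only (`hp : p w → w ∉ S′`), `c ∈ RegG S′`, `a′ ∈ C_c(G′_∞)` and any inversion-invariant Haar
measure `ρ_ι` on `Π_ι T′_{S′,w}` (`ι = {w ∕∕ w ∉ S′ ∧ ¬ p w}`) with coordinates `⊗_ι t_w` (`hρι`),
`chartOrbG ν′ S′ a′ c = (Π_{¬p} t_w(B′_w)) · ∫_{Π_{p} U(α)_w} ( ∫_{(Π_{w∈S′} U_w⧸T′_w) × ((Π_ι U_w)⧸Π_ι T′_w)} a′(e⁻¹((g_w γ_w(c) g_w⁻¹)_{p} ∣ (ẏ_w γ_w(c) ẏ_w⁻¹)_{w∈S′} ∣ ((h γ_ι(c) h⁻¹)_w)_{w∈ι}))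
d((⊗_{S′} ν′_w∕t_w) ⊗ ((⊗_ι ν′_w)∕ρ_ι)) ) d(⊗_{p} ν′_w)(g)` (assembly by Mathlib `piEquivPiSubtypeProd … p`, as ★ (J-iso)^T).  ★ (J-iso)^T, then — inside the `g`-integral — the
index split `{¬p} = S′ ⊔ ι` (an explicit measurable equivalence, measure preserving by `Measure.pi_eq`) and ★ `map_quotientPiHomeomorph_quotientMeasure_pi` on the ι-factor (Bochner
change of variables along measurable equivalences; no Fubini, no integrability). [cite: Folland1995, §2.2; §2.6 Thm. 2.49, (2.52)] [cite: Rogawski1990, §8.2 p. 122; §8.3 p. 124]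
[cite: Gelbart1975, §10 p. 155 (10.19)] [cite: BorelJacquet1979, §4.1] [cite: DeitmarEchterhoff2014, Cor. 1.5.4; Lemma 9.3.3] -/
theorem chartOrbG_eq_prod_mul_integral_pi_group_isolate_splitQuotient (hα : ∀ i, α i ≠ 0) (hS' : ∀ w, w ∈ S' → w ∈ splitChartPlaces L α)
    (hp : ∀ w, p w → w ∉ S') {c : {w : InfinitePlace L // IsComplex w} → Fin 3 → ℝ} (hc : c ∈ ArchCartan.RegG S')
    {a' : ↥(arch (↥(maximalRealSubfield L)) L (IsCMField.complexConj L) 3 (Matrix.diagonal α)) → ℂ} (ha'c : Continuous a') (ha's : HasCompactSupport a') :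
    chartOrbG L α ν' S' a' c =
      (∏ w' : {w : {w : InfinitePlace L // IsComplex w} // ¬ p w}, ((t w'.1 (chartBoxImgGLoc L α w'.1 S')).toReal : ℂ)) *
        ∫ g : (∀ w : {w : {w : InfinitePlace L // IsComplex w} // p w}, ↥(archLocal L 3 (Matrix.diagonal α) w.1)),
          (∫ q : (∀ s : {w : {w : InfinitePlace L // IsComplex w} // w ∈ S'}, ↥(archLocal L 3 (Matrix.diagonal α) s.1) ⧸ chartTorusGLoc L α s.1 S') ×
              ((∀ i : {w : {w : InfinitePlace L // IsComplex w} // w ∉ S' ∧ ¬ p w}, ↥(archLocal L 3 (Matrix.diagonal α) i.1)) ⧸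
                Subgroup.pi Set.univ (fun i : {w : {w : InfinitePlace L // IsComplex w} // w ∉ S' ∧ ¬ p w} => chartTorusGLoc L α i.1 S')),
            a' ((archPiEquivCM 3 L (Matrix.diagonal α)).symm
              ((MeasurableEquiv.piEquivPiSubtypeProd (fun w : {w : InfinitePlace L // IsComplex w} => ↥(archLocal L 3 (Matrix.diagonal α) w)) p).symm
                (fun w => g w * gprimeBlockAt L α w.1 S' (c w.1) * (g w)⁻¹,
                  fun w' : {w : {w : InfinitePlace L // IsComplex w} // ¬ p w} =>
                    if h : w'.1 ∈ S' then
                      descConj (gprimeBlockAt L α w'.1 S' (c w'.1)) (chartTorusGLoc L α w'.1 S') (forall_mem_chartTorusGLoc_comm L α w'.1 S' (c w'.1)) id (q.1 ⟨w'.1, h⟩)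
                    else
                      descConj (fun i : {w : {w : InfinitePlace L // IsComplex w} // w ∉ S' ∧ ¬ p w} => gprimeBlock L α i.1 S' c)
                        (Subgroup.pi Set.univ (fun i : {w : {w : InfinitePlace L // IsComplex w} // w ∉ S' ∧ ¬ p w} => chartTorusGLoc L α i.1 S'))
                        (forall_mem_pi_chartTorusGLoc_comm L α S' (fun i : {w : {w : InfinitePlace L // IsComplex w} // w ∉ S' ∧ ¬ p w} => i.1) c)
                        (fun g' => (g' ⟨w'.1, ⟨h, w'.2⟩⟩ : ↥(archLocal L 3 (Matrix.diagonal α) w'.1))) q.2)))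
            ∂((Measure.pi fun s : {w : {w : InfinitePlace L // IsComplex w} // w ∈ S'} =>
                  quotientMeasure (chartTorusGLoc L α s.1 S') (t s.1) (isClosed_chartTorusGLoc L α s.1 S') (ν'w s.1)).prod
              (quotientMeasure (Subgroup.pi Set.univ (fun i : {w : {w : InfinitePlace L // IsComplex w} // w ∉ S' ∧ ¬ p w} => chartTorusGLoc L α i.1 S')) ρι
                (isClosed_coe_pi _ fun i => isClosed_chartTorusGLoc L α i.1 S')
                (Measure.pi fun i : {w : {w : InfinitePlace L // IsComplex w} // w ∉ S' ∧ ¬ p w} => ν'w i.1))))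
          ∂(Measure.pi fun w : {w : {w : InfinitePlace L // IsComplex w} // p w} => ν'w w.1) := by
  -- ### instances (as ★ (A1) §3 ∕ ★ (J-iso) §2)
  haveI : ∀ w : {w : InfinitePlace L // IsComplex w}, IsClosed (chartTorusGLoc L α w S' : Set ↥(archLocal L 3 (Matrix.diagonal α) w)) :=
    fun w => isClosed_chartTorusGLoc L α w S'
  haveI : ∀ w : {w : InfinitePlace L // IsComplex w}, SecondCountableTopology (↥(archLocal L 3 (Matrix.diagonal α) w) ⧸ chartTorusGLoc L α w S') := fun w => inferInstance
  haveI : ∀ w : {w : InfinitePlace L // IsComplex w},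
      SigmaFinite (quotientMeasure (chartTorusGLoc L α w S') (t w) (isClosed_chartTorusGLoc L α w S') (ν'w w)) := fun w => inferInstance
  haveI : ∀ w, LocallyCompactSpace ↥(chartTorusGLoc L α w S') := fun w => locallyCompactSpace_chartTorusGLoc L α w S'
  haveI : ∀ w, SecondCountableTopology ↥(chartTorusGLoc L α w S') := fun w => TopologicalSpace.Subtype.secondCountableTopology _
  haveI : ∀ w, SigmaFinite (t w) := fun w => inferInstance
  have hMι : IsClosed ((Subgroup.pi Set.univ (fun i : {w : {w : InfinitePlace L // IsComplex w} // w ∉ S' ∧ ¬ p w} => chartTorusGLoc L α i.1 S')) :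
      Set (∀ i : {w : {w : InfinitePlace L // IsComplex w} // w ∉ S' ∧ ¬ p w}, ↥(archLocal L 3 (Matrix.diagonal α) i.1))) :=
    isClosed_coe_pi _ fun i => isClosed_chartTorusGLoc L α i.1 S'
  haveI : LocallyCompactSpace ↥(Subgroup.pi Set.univ (fun i : {w : {w : InfinitePlace L // IsComplex w} // w ∉ S' ∧ ¬ p w} => chartTorusGLoc L α i.1 S')) :=
    hMι.isClosedEmbedding_subtypeVal.locallyCompactSpace
  haveI : SecondCountableTopology ↥(Subgroup.pi Set.univ (fun i : {w : {w : InfinitePlace L // IsComplex w} // w ∉ S' ∧ ¬ p w} => chartTorusGLoc L α i.1 S')) :=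
    TopologicalSpace.Subtype.secondCountableTopology _
  haveI : SFinite ρι := inferInstance
  rw [chartOrbG_eq_prod_mul_integral_pi_group_isolate_of_forall_not_mem L α S' ν'w ν' hν t p hα hS' hp hc ha'c ha's]
  -- ### the index split `{¬p} = S′ ⊔ ι`: an EXPLICIT measurable equivalence from the flat-indexed product, measure preserving (Mathlib `Measure.pi_eq` on boxes)
  obtain ⟨Φ, hΦapp, hΦ⟩ : ∃ Φ : ((∀ s : {w : {w : InfinitePlace L // IsComplex w} // w ∈ S'}, ↥(archLocal L 3 (Matrix.diagonal α) s.1) ⧸ chartTorusGLoc L α s.1 S') ×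
        (∀ i : {w : {w : InfinitePlace L // IsComplex w} // w ∉ S' ∧ ¬ p w}, ↥(archLocal L 3 (Matrix.diagonal α) i.1) ⧸ chartTorusGLoc L α i.1 S')) ≃ᵐ
      (∀ w' : {w : {w : InfinitePlace L // IsComplex w} // ¬ p w}, ↥(archLocal L 3 (Matrix.diagonal α) w'.1) ⧸ chartTorusGLoc L α w'.1 S'),
      (∀ (q : (∀ s : {w : {w : InfinitePlace L // IsComplex w} // w ∈ S'}, ↥(archLocal L 3 (Matrix.diagonal α) s.1) ⧸ chartTorusGLoc L α s.1 S') ×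
          (∀ i : {w : {w : InfinitePlace L // IsComplex w} // w ∉ S' ∧ ¬ p w}, ↥(archLocal L 3 (Matrix.diagonal α) i.1) ⧸ chartTorusGLoc L α i.1 S'))
        (w' : {w : {w : InfinitePlace L // IsComplex w} // ¬ p w}), Φ q w' = if h : w'.1 ∈ S' then q.1 ⟨w'.1, h⟩ else q.2 ⟨w'.1, ⟨h, w'.2⟩⟩) ∧
      MeasurePreserving Φ
        ((Measure.pi fun s : {w : {w : InfinitePlace L // IsComplex w} // w ∈ S'} =>
            quotientMeasure (chartTorusGLoc L α s.1 S') (t s.1) (isClosed_chartTorusGLoc L α s.1 S') (ν'w s.1)).prod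
          (Measure.pi fun i : {w : {w : InfinitePlace L // IsComplex w} // w ∉ S' ∧ ¬ p w} =>
            quotientMeasure (chartTorusGLoc L α i.1 S') (t i.1) (isClosed_chartTorusGLoc L α i.1 S') (ν'w i.1)))
        (Measure.pi fun w' : {w : {w : InfinitePlace L // IsComplex w} // ¬ p w} =>
          quotientMeasure (chartTorusGLoc L α w'.1 S') (t w'.1) (isClosed_chartTorusGLoc L α w'.1 S') (ν'w w'.1)) := by
    obtain ⟨f, hf⟩ : ∃ f : (∀ s : {w : {w : InfinitePlace L // IsComplex w} // w ∈ S'}, ↥(archLocal L 3 (Matrix.diagonal α) s.1) ⧸ chartTorusGLoc L α s.1 S') ×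
          (∀ i : {w : {w : InfinitePlace L // IsComplex w} // w ∉ S' ∧ ¬ p w}, ↥(archLocal L 3 (Matrix.diagonal α) i.1) ⧸ chartTorusGLoc L α i.1 S') →
        (∀ w' : {w : {w : InfinitePlace L // IsComplex w} // ¬ p w}, ↥(archLocal L 3 (Matrix.diagonal α) w'.1) ⧸ chartTorusGLoc L α w'.1 S'),
        f = fun q w' => if h : w'.1 ∈ S' then q.1 ⟨w'.1, h⟩ else q.2 ⟨w'.1, ⟨h, w'.2⟩⟩ := ⟨_, rfl⟩
    have hfapp : ∀ (q : (∀ s : {w : {w : InfinitePlace L // IsComplex w} // w ∈ S'}, ↥(archLocal L 3 (Matrix.diagonal α) s.1) ⧸ chartTorusGLoc L α s.1 S') ×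
          (∀ i : {w : {w : InfinitePlace L // IsComplex w} // w ∉ S' ∧ ¬ p w}, ↥(archLocal L 3 (Matrix.diagonal α) i.1) ⧸ chartTorusGLoc L α i.1 S'))
        (w' : {w : {w : InfinitePlace L // IsComplex w} // ¬ p w}), f q w' = if h : w'.1 ∈ S' then q.1 ⟨w'.1, h⟩ else q.2 ⟨w'.1, ⟨h, w'.2⟩⟩ :=
      fun q w' => by rw [hf]
    refine ⟨{ toFun := f
              invFun := fun b => (fun s => b ⟨s.1, fun h => hp _ h s.2⟩, fun i => b ⟨i.1, i.2.2⟩)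
              left_inv := fun q => ?_
              right_inv := fun b => ?_
              measurable_toFun := ?_
              measurable_invFun := ?_ }, hfapp, ?_⟩
    · refine Prod.ext (funext fun s => ?_) (funext fun i => ?_)
      · show f q ⟨s.1, fun h => hp _ h s.2⟩ = q.1 s
        rw [hfapp, dif_pos s.2]
      · show f q ⟨i.1, i.2.2⟩ = q.2 i
        rw [hfapp, dif_neg i.2.1]
    · funext w'
      show f (fun s => b ⟨s.1, fun h => hp _ h s.2⟩, fun i => b ⟨i.1, i.2.2⟩) w' = b w'
      rw [hfapp]
      by_cases h : w'.1 ∈ S'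
      · rw [dif_pos h]
      · rw [dif_neg h]
    · show Measurable f
      rw [hf]
      exact measurable_pi_lambda _ fun w' => by
        by_cases h : w'.1 ∈ S'
        · simp only [dif_pos h]
          exact (measurable_pi_apply _).comp measurable_fst
        · simp only [dif_neg h]
          exact (measurable_pi_apply _).comp measurable_snd
    · exact (measurable_pi_lambda _ fun s => measurable_pi_apply _).prodMk (measurable_pi_lambda _ fun i => measurable_pi_apply _)
    · refine ⟨MeasurableEquiv.measurable _, (Measure.pi_eq fun s _ => ?_).symm⟩
      have hpre : f ⁻¹' Set.pi Set.univ s =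
          (Set.pi Set.univ fun j : {w : {w : InfinitePlace L // IsComplex w} // w ∈ S'} => s ⟨j.1, fun h => hp _ h j.2⟩) ×ˢ
            Set.pi Set.univ fun i : {w : {w : InfinitePlace L // IsComplex w} // w ∉ S' ∧ ¬ p w} => s ⟨i.1, i.2.2⟩ := by
        ext q
        simp only [Set.mem_preimage, Set.mem_pi, Set.mem_univ, true_implies, Set.mem_prod, hfapp]
        constructor
        · intro hq
          exact ⟨fun j => by simpa only [dif_pos j.2, Subtype.coe_eta] using hq ⟨j.1, fun h => hp _ h j.2⟩,
            fun i => by simpa only [dif_neg i.2.1, Subtype.coe_eta] using hq ⟨i.1, i.2.2⟩⟩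
        · rintro ⟨h₁, h₂⟩ w'
          by_cases h : w'.1 ∈ S'
          · simp only [dif_pos h]
            exact h₁ ⟨w'.1, h⟩
          · simp only [dif_neg h]
            exact h₂ ⟨w'.1, ⟨h, w'.2⟩⟩
      rw [MeasurableEquiv.map_apply, MeasurableEquiv.coe_mk, Equiv.coe_fn_mk, hpre, Measure.prod_prod, Measure.pi_pi, Measure.pi_pi]
      refine Eq.trans ?_ (Fintype.prod_subtype_mul_prod_subtype (fun w' : {w : {w : InfinitePlace L // IsComplex w} // ¬ p w} => w'.1 ∈ S')
        (fun w' => quotientMeasure (chartTorusGLoc L α w'.1 S') (t w'.1) (isClosed_chartTorusGLoc L α w'.1 S') (ν'w w'.1) (s w')))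
      exact congrArg₂ (· * ·)
        (Fintype.prod_equiv (⟨fun j => ⟨⟨j.1, fun h => hp _ h j.2⟩, j.2⟩, fun j => ⟨j.1.1, j.2⟩, fun _ => rfl, fun _ => rfl⟩ :
            {w : {w : InfinitePlace L // IsComplex w} // w ∈ S'} ≃ {w' : {w : {w : InfinitePlace L // IsComplex w} // ¬ p w} // w'.1 ∈ S'}) _ _
          fun _ => rfl)
        (Fintype.prod_equiv (⟨fun i => ⟨⟨i.1, i.2.2⟩, i.2.1⟩, fun j => ⟨j.1.1, ⟨j.2, j.1.2⟩⟩, fun _ => rfl, fun _ => rfl⟩ :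
            {w : {w : InfinitePlace L // IsComplex w} // w ∉ S' ∧ ¬ p w} ≃ {w' : {w : {w : InfinitePlace L // IsComplex w} // ¬ p w} // ¬ w'.1 ∈ S'}) _ _
          fun _ => rfl)
  -- ### the ι-quotients as ONE quotient (★ `map_quotientPiHomeomorph_quotientMeasure_pi`, as ★ (A1) §3)
  set qπ := quotientPiHomeomorph (fun i : {w : {w : InfinitePlace L // IsComplex w} // w ∉ S' ∧ ¬ p w} => chartTorusGLoc L α i.1 S') with hqπ
  have hq : MeasurePreserving qπ.toMeasurableEquiv
      (quotientMeasure (Subgroup.pi Set.univ (fun i : {w : {w : InfinitePlace L // IsComplex w} // w ∉ S' ∧ ¬ p w} => chartTorusGLoc L α i.1 S')) ρι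
        (isClosed_coe_pi _ fun i => isClosed_chartTorusGLoc L α i.1 S')
        (Measure.pi fun i : {w : {w : InfinitePlace L // IsComplex w} // w ∉ S' ∧ ¬ p w} => ν'w i.1))
      (Measure.pi fun i : {w : {w : InfinitePlace L // IsComplex w} // w ∉ S' ∧ ¬ p w} =>
        quotientMeasure (chartTorusGLoc L α i.1 S') (t i.1) (isClosed_chartTorusGLoc L α i.1 S') (ν'w i.1)) :=
    ⟨qπ.toMeasurableEquiv.measurable, by
      rw [Homeomorph.toMeasurableEquiv_coe]
      exact map_quotientPiHomeomorph_quotientMeasure_pi (fun i : {w : {w : InfinitePlace L // IsComplex w} // w ∉ S' ∧ ¬ p w} => chartTorusGLoc L α i.1 S')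
        (fun i => isClosed_chartTorusGLoc L α i.1 S') (fun i => t i.1) ρι hρι (fun i => ν'w i.1)⟩
  have hE := (MeasurePreserving.id (Measure.pi fun s : {w : {w : InfinitePlace L // IsComplex w} // w ∈ S'} =>
      quotientMeasure (chartTorusGLoc L α s.1 S') (t s.1) (isClosed_chartTorusGLoc L α s.1 S') (ν'w s.1))).prod hq
  -- ### the pointwise reading of the re-indexed, re-folded quotient family
  have hpt : ∀ (g : ∀ w : {w : {w : InfinitePlace L // IsComplex w} // p w}, ↥(archLocal L 3 (Matrix.diagonal α) w.1))
      (ys : ∀ s : {w : {w : InfinitePlace L // IsComplex w} // w ∈ S'}, ↥(archLocal L 3 (Matrix.diagonal α) s.1) ⧸ chartTorusGLoc L α s.1 S')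
      (gι : ∀ i : {w : {w : InfinitePlace L // IsComplex w} // w ∉ S' ∧ ¬ p w}, ↥(archLocal L 3 (Matrix.diagonal α) i.1)),
      a' ((archPiEquivCM 3 L (Matrix.diagonal α)).symm
        ((MeasurableEquiv.piEquivPiSubtypeProd (fun w : {w : InfinitePlace L // IsComplex w} => ↥(archLocal L 3 (Matrix.diagonal α) w)) p).symm
          (fun w => g w * gprimeBlockAt L α w.1 S' (c w.1) * (g w)⁻¹,
            fun w' : {w : {w : InfinitePlace L // IsComplex w} // ¬ p w} =>
              descConj (gprimeBlockAt L α w'.1 S' (c w'.1)) (chartTorusGLoc L α w'.1 S') (forall_mem_chartTorusGLoc_comm L α w'.1 S' (c w'.1)) id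
                (Φ (ys, qπ (QuotientGroup.mk gι)) w')))) =
      a' ((archPiEquivCM 3 L (Matrix.diagonal α)).symm
        ((MeasurableEquiv.piEquivPiSubtypeProd (fun w : {w : InfinitePlace L // IsComplex w} => ↥(archLocal L 3 (Matrix.diagonal α) w)) p).symm
          (fun w => g w * gprimeBlockAt L α w.1 S' (c w.1) * (g w)⁻¹,
            fun w' : {w : {w : InfinitePlace L // IsComplex w} // ¬ p w} =>
              if h : w'.1 ∈ S' then
                descConj (gprimeBlockAt L α w'.1 S' (c w'.1)) (chartTorusGLoc L α w'.1 S') (forall_mem_chartTorusGLoc_comm L α w'.1 S' (c w'.1)) id (ys ⟨w'.1, h⟩)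
              else
                descConj (fun i : {w : {w : InfinitePlace L // IsComplex w} // w ∉ S' ∧ ¬ p w} => gprimeBlock L α i.1 S' c)
                  (Subgroup.pi Set.univ (fun i : {w : {w : InfinitePlace L // IsComplex w} // w ∉ S' ∧ ¬ p w} => chartTorusGLoc L α i.1 S'))
                  (forall_mem_pi_chartTorusGLoc_comm L α S' (fun i : {w : {w : InfinitePlace L // IsComplex w} // w ∉ S' ∧ ¬ p w} => i.1) c)
                  (fun g' => (g' ⟨w'.1, ⟨h, w'.2⟩⟩ : ↥(archLocal L 3 (Matrix.diagonal α) w'.1))) (QuotientGroup.mk gι)))) := by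
    intro g ys gι
    refine congrArg (fun V : (∀ w' : {w : {w : InfinitePlace L // IsComplex w} // ¬ p w}, ↥(archLocal L 3 (Matrix.diagonal α) w'.1)) =>
      a' ((archPiEquivCM 3 L (Matrix.diagonal α)).symm
        ((MeasurableEquiv.piEquivPiSubtypeProd (fun w : {w : InfinitePlace L // IsComplex w} => ↥(archLocal L 3 (Matrix.diagonal α) w)) p).symm
          (fun w => g w * gprimeBlockAt L α w.1 S' (c w.1) * (g w)⁻¹, V)))) (funext fun w' => ?_)
    rw [hΦapp]
    by_cases h : w'.1 ∈ S'
    · rw [dif_pos h, dif_pos h]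
    · rw [dif_neg h, dif_neg h]
      simp only [hqπ, coe_quotientPiHomeomorph, quotientPiEquiv_mk, descConj_mk, id_eq, Pi.mul_apply, Pi.inv_apply, gprimeBlock_eq_gprimeBlockAt]
  -- ### assemble: Bochner change of variables along `Φ` and `id × qπ` inside the `g`-integral
  congr 1
  refine integral_congr_ae (Filter.Eventually.of_forall fun g => ?_)
  simp only []
  rw [← hΦ.integral_comp', ← hE.integral_comp' (f := MeasurableEquiv.prodCongr (MeasurableEquiv.refl _) qπ.toMeasurableEquiv)]
  refine integral_congr_ae (Filter.Eventually.of_forall fun q => ?_)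
  obtain ⟨ys, z⟩ := q
  induction z using QuotientGroup.induction_on with
  | H gι => exact hpt g ys gι

end IsolateFinsetSplitQuotient

end Literature.NumberTheory.Automorphic.UnitaryGroup

end
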